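import Summits.AtomisticToContinuum.BoseEinsteinCondensation.Theses.BECJosephsonSlackThreshold
import Literature.MathematicalPhysics.QuantumManyBody.BoseGasFreeDirichletBEC

/-!
# Crux `MesoscopicVacancy` (piece 2 of the infrared split of `JosephsonSlackCondensation`, stmt-9780) —
# line `grain-gluing`: local flat condensation in large grains ∧ gluing of the grain field

Skeleton (crux-strategist cstrat-stmt-AtomisticToContinuum-9780). `MesoscopicVacancy` = for small `ρ`
and every `θ > 0` there are `K₀, Λ, κ > 0` such that, eventually in `N`, for every κN/L²-near-minimiser
the Neumann modes of the box with `K₀ < π|k| ≤ ΛL` (all mesoscopic wavelengths, from `~1/Λ` up to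
`~L/K₀`) carry at most `θN`:
`mass({0} ∪ lowModes(ΛL)) ≤ mass({0} ∪ lowModes(K₀)) + θN`.
The classical two-step structure of a thermodynamic-limit condensation proof, with the gluing step
isolated as the stub that carries the difficulty:

* `stub_localFlatness` — LOCAL FLAT CONDENSATION AT ARBITRARILY LARGE FIXED SCALES (size L; open
  beyond the Fournais2020/Junge2026 reach `ℓ₀ ≲ (ρa)^{-1/2}(ρa³)^{-η}`, where it is the in-tree
  `Fournais2020_condensation` / `Junge2026_neumannBox_pinnedLowerBound` technology + Neumann
  bracketing): for small `ρ` and every prescribed `ℓ_A > 0` there are a grain side `ℓ₀ ≥ ℓ_A` and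
  `κ > 0` such that, eventually in `N`, every κN/L²-near-minimiser has `≥ 3N/4` particles in the flat
  modes `u_q = ℓ^{-3/2} 1_{Q_q}` (`BoseGas.subMode`) of the `k³` grains of side `ℓ = L/k ∈ (ℓ₀/2, ℓ₀]`,
  `k = ⌈L/ℓ₀⌉`, tiling the box;
* `stub_grainGluing` — THE HEART (stiffness of the grain field at the Josephson scale): for small `ρ`
  there is a threshold `ℓ_A > 0` (the grains must be larger than the healing length, else local
  flatness is automatic and the stub would restate the crux) such that for every grain side
  `ℓ₀ ≥ ℓ_A` and every `θ > 0` there are `K₀, Λ, κ > 0` with: eventually in `N`, every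
  κN/L²-near-minimiser that is locally flat at scale `ℓ₀` (as delivered by `stub_localFlatness`) has
  mesoscopic-window mass `≤ θN` — the grain amplitudes/phases cannot vary at wavelengths between
  `~1/Λ` and `~L/K₀` at energy cost `≤ κN/L²` (Nozières' exchange penalty for overlapping fragments,
  IMS / Lieb–Solovej localisation for separated ones; the converse of the route's `FilterFragmentation`);
* `mesoscopicVacancy_glue` / `MesoscopicVacancy_of` — PROVED composition (threshold `ℓ_A` from the gluing stub, grains `ℓ₀ ≥ ℓ_A`
  from local flatness, `κ := min`, filters intersected, slack monotone in `κ`).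
-/

open Filter MeasureTheory
open scoped ENNReal

namespace Summit.AtomisticToContinuum.BoseEinsteinCondensation.Cruxes.MesoscopicVacancy.GrainGluing

open Literature.MathematicalPhysics.QuantumManyBody
open Literature.MathematicalPhysics.QuantumManyBody.BoseGas
open Literature.MathematicalPhysics.QuantumManyBody.NeumannBox
open Summit.AtomisticToContinuum.BoseEinsteinCondensation.Theses.BECJosephsonSlackThreshold

/-! ### Abbreviations (the crux `MesoscopicVacancy` itself is the ROUTE decl, opened above) -/

/-- The infrared mass below the index cutoff `K` (momenta `|p| ≤ K/L`):
`∑_{k ∈ {0} ∪ lowModes K} ⟨u_k 1_Λ, γ_Ψ u_k 1_Λ⟩`. Local abbreviation. -/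
noncomputable abbrev irMass (K L : ℝ) (N : ℕ) (Ψ : Config N → ℂ) : ℝ≥0∞ :=
  ∑ k ∈ insert (0 : Fin 3 → ℕ) (NeumannBox.lowModes K),
    BoseGas.cellOccupation N L (fun x => ((NeumannBox.mode L k x : ℝ) : ℂ)) Ψ

/-- LOCAL FLATNESS at grain side `≈ ℓ₀` with defect `≤ N/4`: the `k³` flat grain modes of side
`L/k`, `k = ⌈L/ℓ₀⌉`, carry `≥ 3N/4`. Local abbreviation (a hypothesis shape, not a fact). [folklore] -/
noncomputable abbrev LocallyFlat (ℓ₀ L : ℝ) (N : ℕ) (Ψ : Config N → ℂ) : Prop :=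
  ENNReal.ofReal (3 / 4 * N) ≤
    ∑ q : BoseGas.SubIdx ⌈L / ℓ₀⌉₊, BoseGas.occupation N (BoseGas.subMode (L / ⌈L / ℓ₀⌉₊) q) Ψ

/-! ### Registered stubs -/

/-- **LOCAL FLATNESS AT LARGE FIXED SCALES** (stub, size L): for small `ρ` and every prescribed
`ℓ_A > 0` there are a grain side `ℓ₀ ≥ ℓ_A` and a slack `κ > 0` such that, eventually in `N`, every
κN/L²-near-minimiser is locally flat at scale `ℓ₀` (flat grain modes carry `≥ 3N/4`). -/
theorem stub_localFlatness :
    ∀ v : ℝ → ENNReal, BoseGas.IsRepulsiveFiniteRange v → ∃ ρ₀ : ℝ, 0 < ρ₀ ∧ ∀ ρ : ℝ, 0 < ρ → ρ < ρ₀ →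
      ∀ ℓA : ℝ, 0 < ℓA → ∃ ℓ₀ κ : ℝ, ℓA ≤ ℓ₀ ∧ 0 < κ ∧ ∀ᶠ N : ℕ in Filter.atTop,
        ∀ Ψ : BoseGas.TrialState N (BoseGas.sideLength ρ N),
          BoseGas.energy v Ψ ≤ BoseGas.groundStateEnergy v N (BoseGas.sideLength ρ N) +
              ENNReal.ofReal (κ * N / BoseGas.sideLength ρ N ^ 2) →
            LocallyFlat ℓ₀ (BoseGas.sideLength ρ N) N Ψ.ψ := by
  sorry

/-- **GRAIN GLUING** (stub, THE HEART, open): for small `ρ` there is a threshold `ℓ_A > 0` such that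
for every grain side `ℓ₀ ≥ ℓ_A` and every `θ > 0` there are `K₀, Λ, κ > 0` with: eventually in `N`,
every κN/L²-near-minimiser that is locally flat at scale `ℓ₀` has mesoscopic-window mass `≤ θN`. -/
theorem stub_grainGluing :
    ∀ v : ℝ → ENNReal, BoseGas.IsRepulsiveFiniteRange v → ∃ ρ₀ : ℝ, 0 < ρ₀ ∧ ∀ ρ : ℝ, 0 < ρ → ρ < ρ₀ →
      ∃ ℓA : ℝ, 0 < ℓA ∧ ∀ ℓ₀ : ℝ, ℓA ≤ ℓ₀ → ∀ θ : ℝ, 0 < θ →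
        ∃ K₀ Λ κ : ℝ, 0 < K₀ ∧ 0 < Λ ∧ 0 < κ ∧ ∀ᶠ N : ℕ in Filter.atTop,
          ∀ Ψ : BoseGas.TrialState N (BoseGas.sideLength ρ N),
            BoseGas.energy v Ψ ≤ BoseGas.groundStateEnergy v N (BoseGas.sideLength ρ N) +
                ENNReal.ofReal (κ * N / BoseGas.sideLength ρ N ^ 2) →
              LocallyFlat ℓ₀ (BoseGas.sideLength ρ N) N Ψ.ψ →
                irMass (Λ * BoseGas.sideLength ρ N) (BoseGas.sideLength ρ N) N Ψ.ψ ≤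
                  irMass K₀ (BoseGas.sideLength ρ N) N Ψ.ψ + ENNReal.ofReal (θ * N) := by
  sorry

/-! ### Proved glue of the line -/

/-- **Composition of the line** (proved): the gluing threshold `ℓ_A`, grains `ℓ₀ ≥ ℓ_A` on which
near-minimisers are locally flat, then gluing at tolerance `θ` — the crux `MesoscopicVacancy`. -/
theorem mesoscopicVacancy_glue
    (hB : ∀ v : ℝ → ENNReal, BoseGas.IsRepulsiveFiniteRange v → ∃ ρ₀ : ℝ, 0 < ρ₀ ∧ ∀ ρ : ℝ, 0 < ρ → ρ < ρ₀ →
      ∀ ℓA : ℝ, 0 < ℓA → ∃ ℓ₀ κ : ℝ, ℓA ≤ ℓ₀ ∧ 0 < κ ∧ ∀ᶠ N : ℕ in Filter.atTop,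
        ∀ Ψ : BoseGas.TrialState N (BoseGas.sideLength ρ N),
          BoseGas.energy v Ψ ≤ BoseGas.groundStateEnergy v N (BoseGas.sideLength ρ N) +
              ENNReal.ofReal (κ * N / BoseGas.sideLength ρ N ^ 2) →
            LocallyFlat ℓ₀ (BoseGas.sideLength ρ N) N Ψ.ψ)
    (hA : ∀ v : ℝ → ENNReal, BoseGas.IsRepulsiveFiniteRange v → ∃ ρ₀ : ℝ, 0 < ρ₀ ∧ ∀ ρ : ℝ, 0 < ρ → ρ < ρ₀ →
      ∃ ℓA : ℝ, 0 < ℓA ∧ ∀ ℓ₀ : ℝ, ℓA ≤ ℓ₀ → ∀ θ : ℝ, 0 < θ →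
        ∃ K₀ Λ κ : ℝ, 0 < K₀ ∧ 0 < Λ ∧ 0 < κ ∧ ∀ᶠ N : ℕ in Filter.atTop,
          ∀ Ψ : BoseGas.TrialState N (BoseGas.sideLength ρ N),
            BoseGas.energy v Ψ ≤ BoseGas.groundStateEnergy v N (BoseGas.sideLength ρ N) +
                ENNReal.ofReal (κ * N / BoseGas.sideLength ρ N ^ 2) →
              LocallyFlat ℓ₀ (BoseGas.sideLength ρ N) N Ψ.ψ →
                irMass (Λ * BoseGas.sideLength ρ N) (BoseGas.sideLength ρ N) N Ψ.ψ ≤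
                  irMass K₀ (BoseGas.sideLength ρ N) N Ψ.ψ + ENNReal.ofReal (θ * N)) :
  ∀ v : ℝ → ENNReal, BoseGas.IsRepulsiveFiniteRange v → ∃ ρ₀ : ℝ, 0 < ρ₀ ∧ ∀ ρ : ℝ, 0 < ρ → ρ < ρ₀ →
    ∀ θ : ℝ, 0 < θ → ∃ K₀ Λ κ : ℝ, 0 < K₀ ∧ 0 < Λ ∧ 0 < κ ∧ ∀ᶠ N : ℕ in Filter.atTop,
      ∀ Ψ : BoseGas.TrialState N (BoseGas.sideLength ρ N),
        BoseGas.energy v Ψ ≤ BoseGas.groundStateEnergy v N (BoseGas.sideLength ρ N) +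
            ENNReal.ofReal (κ * N / BoseGas.sideLength ρ N ^ 2) →
          ∑ k ∈ insert (0 : Fin 3 → ℕ) (NeumannBox.lowModes (Λ * BoseGas.sideLength ρ N)),
              BoseGas.cellOccupation N (BoseGas.sideLength ρ N)
                (fun x => ((NeumannBox.mode (BoseGas.sideLength ρ N) k x : ℝ) : ℂ)) Ψ.ψ ≤
            (∑ k ∈ insert (0 : Fin 3 → ℕ) (NeumannBox.lowModes K₀),
              BoseGas.cellOccupation N (BoseGas.sideLength ρ N)
                (fun x => ((NeumannBox.mode (BoseGas.sideLength ρ N) k x : ℝ) : ℂ)) Ψ.ψ) +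
              ENNReal.ofReal (θ * N) := by
  intro v hv
  obtain ⟨ρ₁, hρ₁, HB⟩ := hB v hv
  obtain ⟨ρ₂, hρ₂, HA⟩ := hA v hv
  refine ⟨min ρ₁ ρ₂, lt_min hρ₁ hρ₂, fun ρ hρ hρlt θ hθ => ?_⟩
  -- the gluing threshold, then grains at least that large on which near-minimisers are flat
  obtain ⟨ℓA, hℓA, HA'⟩ := HA ρ hρ (hρlt.trans_le (min_le_right _ _))
  obtain ⟨ℓ₀, κB, hℓ₀, hκB, HB'⟩ := HB ρ hρ (hρlt.trans_le (min_le_left _ _)) ℓA hℓA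
  obtain ⟨K₀, Λ, κA, hK₀, hΛ, hκA, HA''⟩ := HA' ℓ₀ hℓ₀ θ hθ
  refine ⟨K₀, Λ, min κA κB, hK₀, hΛ, lt_min hκA hκB, ?_⟩
  filter_upwards [HA'', HB'] with N hNA hNB Ψ hΨ
  have hmono : ∀ κ' : ℝ, min κA κB ≤ κ' →
      BoseGas.energy v Ψ ≤ BoseGas.groundStateEnergy v N (BoseGas.sideLength ρ N) +
        ENNReal.ofReal (κ' * N / BoseGas.sideLength ρ N ^ 2) := by
    intro κ' hκ'
    refine hΨ.trans (add_le_add le_rfl (ENNReal.ofReal_le_ofReal ?_))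
    have hNL : 0 ≤ (N : ℝ) / BoseGas.sideLength ρ N ^ 2 := div_nonneg N.cast_nonneg (sq_nonneg _)
    calc min κA κB * N / BoseGas.sideLength ρ N ^ 2
        = min κA κB * (N / BoseGas.sideLength ρ N ^ 2) := by ring
      _ ≤ κ' * (N / BoseGas.sideLength ρ N ^ 2) := mul_le_mul_of_nonneg_right hκ' hNL
      _ = κ' * N / BoseGas.sideLength ρ N ^ 2 := by ring
  exact hNA Ψ (hmono κA (min_le_left _ _)) (hNB Ψ (hmono κB (min_le_right _ _)))

/-- The line concludes the crux BY NAME from its two registered stubs. -/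
theorem MesoscopicVacancy_of : Summit.AtomisticToContinuum.BoseEinsteinCondensation.Theses.BECJosephsonSlackThreshold.MesoscopicVacancy :=
  mesoscopicVacancy_glue stub_localFlatness stub_grainGluing

end Summit.AtomisticToContinuum.BoseEinsteinCondensation.Cruxes.MesoscopicVacancy.GrainGluing
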